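import Summits.QuantumFields.BalabanUV.T4Continuum.Support.InsertionChannelFamilyPiece
import Mathlib.LinearAlgebra.Basis.VectorSpace

/-!
# InsertionChannelFamilyLinear — the channel road CARRIED TO ROAD D, part 3: the REPAIR of the located design fact D-ne5leaf06g12-1 —
# a per-chart-point channel insertion that is ℝ-LINEAR ON ALL FUNCTION TABLES (the faithful one on the chart-bounded tables, extended
# through a Hamel retraction `LinearMap.exists_extend`), for which EVERY structural insertion binder of the kernel (`InsAffine`,
# `InsHomog`, `InsBlind`) holds EXACTLY on leaf-02's family model together with MI-3a — so the END faces of record that carry the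
# structural binders apply on Road D as well
# (cell `pub-balaban`, T⁴ fan-out; row NE5, node U3; `HOME/t4/formal/NE5/LEAVES.md` row O1-c follower; INTENT in `HOME/CLAIMS.log`)

Unit `b2b-balaban-t4-ne5-formalise-leaf-06` (NE5 formalisation swarm, leaf prover 06, gen 12).  Summits-side NEW WORK under the
LEAN PLACEMENT RULE (cell modelling + bookkeeping over ABSTRACT carriers; nothing of the manuscripts under audit is asserted; 0 cite
tags; no `Prop`-valued fact minted — trigger c3).  HONEST FRAMING: rung (B)+1 of the FINITE-VOLUME T⁴ continuum programme — NOT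
infinite volume, NOT a mass gap, NOT the Clay problem, NOT a proof of NE5 (NOT PRINTED; cell GAPS G-t4-U3-1) nor of NE9; spine 0/9;
0/12 leaves instantiated on Bałaban's concrete objects (O1 = the substrate cell, owner R34).  HONEST DEPENDENCY (cell line,
verbatim): continuum YM on T⁴ ⇐ BetaPertH ∧ nine spine estimates (0/9 proved); BetaPertH ⇐ (D1) ∧ (D4) ∧ CAP+tail; G-an2-4 gates
asym, D1 and NE2/3/4.

WHY.  Part 1 (`InsertionChannelFamily`) located D-ne5leaf06g12-1: on Road D the by-construction channel insertion `insAtOfChannel`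
(`tableOf` ∕ `famOf`, junk `0` on chart-unbounded tables) satisfies MI-3a but NOT the kernel's all-tables identity `StepModel.InsAffine`
(part 2's `toy_not_insAffine`), while many END faces of record (E1′ `ne5_at_of_stepModel_fibre_scale_nat`, E1[rec], E8[rec], E9[rec],
the cores END) carry `InsAffine ∧ InsBlind ∧ InsHomog` as structural binders.  THE REPAIR typed here: the tables whose step-`k` channel
entries are level-bounded UNIFORMLY IN THE CHART form an ℝ-SUBSPACE `goodTables` (the channel being additive AND homogeneous on all
families — `ChannelAdditive univ`, `ChannelHomog univ`, row NE9's displayed structure); a linear RETRACTION `π` of all tables onto it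
exists (Hamel, `LinearMap.exists_extend`; non-constructive, non-canonical); and `insLinOfChannel … (k+1) t := insAtOfChannel … (k+1) (π t)`
is the faithful insertion on the good tables, never meets the junk value, and is AFFINE, HOMOGENEOUS and BLIND on ALL tables, with the
damped-Lipschitz bound of part 1 intact (the kernel's bounds only ever constrain DIFFERENCES that are good, and `π` fixes those).
Physically nothing changes: the runs' own function tables are good under the one-run decay bounds ([I] (1.18) on 𝐔^c — displayed
hypotheses of every END), and the kernel's binders never read a bad table except through a good difference.

WHAT THIS FILE TYPES ([folklore] bookkeeping; 0 sorry; row NE9's shapes enter BY NAME as displayed hypotheses, none is discharged):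
* §1 `exists_retraction` ∕ `retraction p` ∕ `retraction_of_mem` — a linear retraction of an ℝ-vector space onto a subspace (Hamel).
* §2 `rawLin T out k g : (C.Dom × 𝒰 → ℝ) →ₗ[ℝ] (𝒰 × F.Idx → ℝ)` (the step-`k` channel entries as a LINEAR map of the function table;
  `ChannelAdditive univ` + `ChannelHomog univ`), the subspace `goodTables T out k g` (entries `≤ μ·F.wt i` uniformly in the chart),
  `mem_goodTables_of_bound` (tables with channel-bounded differences — in particular the decaying ones of the kernel's hypotheses — are
  good), `sub_mem_goodTables_of_agree` (tables agreeing on the scales `≤ k` differ by a good table, `ChannelLocal univ`).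
* §3 DATA `insLinOfChannel T out g : ℕ → (C.Dom × 𝒰 → ℝ) → 𝒰 → Hist F` (step `k+1`: part 1's `insAtOfChannel` AFTER the retraction onto
  `goodTables T out k g`); `insLin_eq_insAt_of_mem` (faithful on good tables), `read_insLin_succ` (the reading, junk-free for EVERY
  table: entries of `π t`), `bddAbove_insLin` ∕ `famOf_insLin_apply` (bounded over the chart for EVERY table — `famOf` is always verbatim).
* part 4 `InsertionChannelFamilyLinearBinders`: ALL kernel insertion binders (`InsAffine`, `InsHomog`, `InsBlind` exact; MI-3a) of
  leaf-02's family model for per-background slots whose run-A insertion IS `insLinOfChannel`, and the toy contrast with part 2's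
  `toy_not_insAffine`.
NOT IN THIS FILE (said plainly).  The retraction is NON-CONSTRUCTIVE and NOT CANONICAL (any other retraction gives another model with
the same faithful part); no instance on Bałaban's objects; no NE9 binder discharged; no W1 ∕ W2 ∕ representation hypothesis touched;
no estimate of [II].  Headline wording: «NE5 channel road carried to Road D — structural binders restored by a linear extension;
junction only»; never «leaf instantiated».  NE5 NOT PROVED; NE9 NOT PROVED; spine 0/9; rung (B)+1 finite T⁴; NOT infinite volume ∕
mass gap ∕ Clay.  Axioms ⊆ {propext, Classical.choice, Quot.sound}.
-/

noncomputable section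

open scoped BigOperators
open Finset Function Metric Set

namespace Summit.QuantumFields.BalabanUV.T4Continuum.InsertionChannelFamily

open Literature.MathematicalPhysics.QuantumFieldTheory.Balaban1983to89
open Literature.MathematicalPhysics.QuantumFieldTheory.Balaban1983to89.T4OutputRate (Carriers)
open Literature.MathematicalPhysics.QuantumFieldTheory.Balaban1983to89.T4InputCauchyRate (toyCarriers)
open Literature.MathematicalPhysics.QuantumFieldTheory.Balaban1983to89.T4InputCauchyRateData (StepModel mul_sum_age_shift)
open Literature.MathematicalPhysics.QuantumFieldTheory.Balaban1983to89.T4HistoryLipschitzRecursion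
  (ChannelAdditive ChannelLocal ChannelStepSum ChannelSizeAtStepNN truncScale)
open Summit.QuantumFields.BalabanUV.T4Continuum.B13HistDatum (HistFrame Hist)
open Summit.QuantumFields.BalabanUV.T4Continuum.InsertionChannelReading (ChannelHomog read_sub read_smul eq_of_read_eq)
open Summit.QuantumFields.BalabanUV.T4Continuum.InsertionChannelInstance (tableOf read_tableOf)
open Summit.QuantumFields.BalabanUV.T4Continuum.OutputRateFunctionalTables
open Summit.QuantumFields.BalabanUV.T4Continuum.OutputRateFunctionalTablesFamily (Fam famOf famOf_apply toBgFamily norm_famOf_sub_famOf_le)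
open Summit.QuantumFields.BalabanUV.T4Continuum.OutputRateFunctionalTablesPointwise (PointwiseSlots)

/-! ## §1 A linear retraction onto a subspace (Hamel) -/

section Retraction

variable {V : Type*} [AddCommGroup V] [Module ℝ V]

/-- [folklore] Every subspace of an ℝ-vector space is a LINEAR RETRACT: the identity of the subspace extends to a linear map of the
whole space into the subspace (`LinearMap.exists_extend` — a Hamel-basis argument; non-constructive). -/
theorem exists_retraction (p : Submodule ℝ V) : ∃ π : V →ₗ[ℝ] p, ∀ s : p, π s = s := by
  obtain ⟨g, hg⟩ := LinearMap.exists_extend (LinearMap.id : p →ₗ[ℝ] p)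
  exact ⟨g, fun s => by simpa using LinearMap.congr_fun hg s⟩

/-- [folklore] DATA: a CHOSEN linear retraction onto the subspace `p` (non-canonical). -/
def retraction (p : Submodule ℝ V) : V →ₗ[ℝ] p := Classical.choose (exists_retraction p)

/-- [folklore] The retraction fixes the subspace. -/
theorem retraction_apply_mem (p : Submodule ℝ V) (s : p) : retraction p s = s :=
  Classical.choose_spec (exists_retraction p) s

/-- [folklore] The retraction fixes every member of the subspace (as a vector). -/
theorem retraction_of_mem (p : Submodule ℝ V) {v : V} (hv : v ∈ p) : (retraction p v : V) = v := by
  have h := retraction_apply_mem p ⟨v, hv⟩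
  simpa using congrArg Subtype.val h

end Retraction

variable {C : Carriers} {𝒰 ι : Type} {F : HistFrame C}

/-! ## §2 The step-`k` channel entries as a linear map of the function table; the subspace of good tables -/

section Good

variable (T : ℕ → (ℕ → ℝ) → (𝒰 → C.Dom → ℝ) → ι → ℝ)

/-- [folklore] An additive channel kills the zero family. -/
theorem channel_zero (hadd : ChannelAdditive (Set.univ : Set (𝒰 → C.Dom → ℝ)) T) (k : ℕ) (g : ℕ → ℝ) (y : ι) :
    T k g 0 y = 0 := by
  have h := hadd k g 0 (Set.mem_univ _) 0 (Set.mem_univ _) y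
  rw [sub_self] at h
  linarith

/-- [folklore] An additive channel is additive on sums (all families admissible). -/
theorem channel_add (hadd : ChannelAdditive (Set.univ : Set (𝒰 → C.Dom → ℝ)) T) (k : ℕ) (g : ℕ → ℝ)
    (H H' : 𝒰 → C.Dom → ℝ) (y : ι) : T k g (H + H') y = T k g H y + T k g H' y := by
  have h := hadd k g (H + H') (Set.mem_univ _) H' (Set.mem_univ _) y
  rw [add_sub_cancel_right] at h
  linarith

variable {T} in
/-- [folklore] DATA: **THE STEP-`k` CHANNEL ENTRIES AS AN ℝ-LINEAR MAP OF THE FUNCTION TABLE** — `t ↦ ((u, i) ↦ T k g (toBgFamily t) (out u i))`,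
linear by `ChannelAdditive univ` and `ChannelHomog univ` (row NE9's displayed structure: every localization operation of [II] p. 6–7 is
linear in each earlier term). -/
def rawLin (hadd : ChannelAdditive (Set.univ : Set (𝒰 → C.Dom → ℝ)) T) (hhom : ChannelHomog (Set.univ : Set (𝒰 → C.Dom → ℝ)) T)
    (out : 𝒰 → F.Idx → ι) (k : ℕ) (g : ℕ → ℝ) : (C.Dom × 𝒰 → ℝ) →ₗ[ℝ] (𝒰 × F.Idx → ℝ) where
  toFun t := fun p => T k g (toBgFamily t) (out p.1 p.2)
  map_add' t t' := by
    funext p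
    show T k g (toBgFamily (t + t')) (out p.1 p.2) = T k g (toBgFamily t) (out p.1 p.2) + T k g (toBgFamily t') (out p.1 p.2)
    exact channel_add T hadd k g _ _ _
  map_smul' a t := by
    funext p
    show T k g (toBgFamily (a • t)) (out p.1 p.2) = a * T k g (toBgFamily t) (out p.1 p.2)
    exact hhom k g _ (Set.mem_univ _) a _

variable {T}
variable (hadd : ChannelAdditive (Set.univ : Set (𝒰 → C.Dom → ℝ)) T) (hhom : ChannelHomog (Set.univ : Set (𝒰 → C.Dom → ℝ)) T)
  (out : 𝒰 → F.Idx → ι)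

/-- [folklore] `rawLin`, evaluated. -/
@[simp] theorem rawLin_apply (k : ℕ) (g : ℕ → ℝ) (t : C.Dom × 𝒰 → ℝ) (p : 𝒰 × F.Idx) :
    rawLin hadd hhom out k g t p = T k g (toBgFamily t) (out p.1 p.2) := rfl

/-- [folklore] DATA: **THE GOOD TABLES AT STEP `k`** — the ℝ-subspace of function tables whose step-`k` channel entries are bounded against
the level formats UNIFORMLY IN THE CHART (the tables on which the by-construction insertion of part 1 is faithful at every chart point
AND bounded over the chart). -/
def goodTables (k : ℕ) (g : ℕ → ℝ) : Submodule ℝ (C.Dom × 𝒰 → ℝ) where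
  carrier := {t | ∃ μ : ℝ, ∀ (u : 𝒰) (i : F.Idx), |T k g (toBgFamily t) (out u i)| ≤ μ * F.wt i}
  add_mem' := by
    rintro a b ⟨μ, hμ⟩ ⟨ν, hν⟩
    refine ⟨μ + ν, fun u i => ?_⟩
    have h := congrFun ((rawLin hadd hhom out k g).map_add a b) (u, i)
    simp only [rawLin_apply, Pi.add_apply] at h
    rw [h]
    calc |T k g (toBgFamily a) (out u i) + T k g (toBgFamily b) (out u i)|
        ≤ |T k g (toBgFamily a) (out u i)| + |T k g (toBgFamily b) (out u i)| := abs_add_le _ _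
      _ ≤ μ * F.wt i + ν * F.wt i := add_le_add (hμ u i) (hν u i)
      _ = (μ + ν) * F.wt i := by ring
  zero_mem' := ⟨0, fun u i => by
    show |T k g (toBgFamily 0) (out u i)| ≤ 0 * F.wt i
    rw [show toBgFamily (0 : C.Dom × 𝒰 → ℝ) = 0 from rfl, channel_zero T hadd, abs_zero, zero_mul]⟩
  smul_mem' := by
    rintro c t ⟨μ, hμ⟩
    refine ⟨|c| * μ, fun u i => ?_⟩
    show |T k g (toBgFamily (c • t)) (out u i)| ≤ |c| * μ * F.wt i
    rw [show toBgFamily (c • t) = c • toBgFamily t from rfl, hhom k g _ (Set.mem_univ _) c, abs_mul, mul_assoc]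
    exact mul_le_mul_of_nonneg_left (hμ u i) (abs_nonneg c)

/-- [folklore] Membership in the good tables, displayed. -/
theorem mem_goodTables_iff {k : ℕ} {g : ℕ → ℝ} {t : C.Dom × 𝒰 → ℝ} :
    t ∈ goodTables hadd hhom out k g ↔
      ∃ μ : ℝ, ∀ (u : 𝒰) (i : F.Idx), |T k g (toBgFamily t) (out u i)| ≤ μ * F.wt i := Iff.rfl

/-- [folklore] **A TABLE WHOSE CHANNEL ENTRIES OBEY THE SIZE BINDER IS GOOD**: if `|t (Y, u)| ≤ D(scale Y)·e^{−κd(Y)}` on the scales `≤ k`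
uniformly in the chart (the kernel's hypotheses on the runs' tables and on their differences), then `t` is good at step `k` — from the
step-sum structure, row NE9's size binder and the weight dictionary (`abs_channel_sub_le` of part 1 against the zero table). -/
theorem mem_goodTables_of_bound {κ : ℝ} {wt : ℕ → ι → ℝ} {τ : ℕ → ℕ → ℝ} {rH : ℕ → ℝ}
    (hsum : ChannelStepSum (Set.univ : Set (𝒰 → C.Dom → ℝ)) T) (hsize : ChannelSizeAtStepNN (Set.univ : Set (𝒰 → C.Dom → ℝ)) T κ wt τ)
    (hwt0 : ∀ k u i, 0 ≤ wt k (out u i)) (hwt : ∀ k u i, wt k (out u i) ≤ rH (k + 1) * F.wt i) {k : ℕ} (g : ℕ → ℝ)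
    {t : C.Dom × 𝒰 → ℝ} {D : ℕ → ℝ} (hD : ∀ j ≤ k, 0 ≤ D j)
    (hb : ∀ Y, C.scale Y ≤ k → ∀ u, |t (Y, u)| ≤ D (C.scale Y) * Real.exp (-(κ * C.d Y))) :
    t ∈ goodTables hadd hhom out k g := by
  refine ⟨rH (k + 1) * |∑ j ∈ range (k + 1), τ k j * D j|, fun u i => ?_⟩
  have h := abs_channel_sub_le hadd hsum hsize g (t := t) (t' := 0) hD (fun Y hY u => by simpa using hb Y hY u) (out u i)
  rw [show toBgFamily (0 : C.Dom × 𝒰 → ℝ) = 0 from rfl, channel_zero T hadd, sub_zero] at h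
  calc |T k g (toBgFamily t) (out u i)| ≤ wt k (out u i) * ∑ j ∈ range (k + 1), τ k j * D j := h
    _ ≤ wt k (out u i) * |∑ j ∈ range (k + 1), τ k j * D j| := mul_le_mul_of_nonneg_left (le_abs_self _) (hwt0 k u i)
    _ ≤ rH (k + 1) * F.wt i * |∑ j ∈ range (k + 1), τ k j * D j| := mul_le_mul_of_nonneg_right (hwt k u i) (abs_nonneg _)
    _ = rH (k + 1) * |∑ j ∈ range (k + 1), τ k j * D j| * F.wt i := by ring

/-- [folklore] **TABLES AGREEING ON THE SCALES `≤ k` DIFFER BY A GOOD TABLE** (`ChannelLocal univ T`: the step-`k` channel does not read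
the difference at all). -/
theorem sub_mem_goodTables_of_agree (hloc : ChannelLocal (Set.univ : Set (𝒰 → C.Dom → ℝ)) T) {k : ℕ} (g : ℕ → ℝ)
    {t t' : C.Dom × 𝒰 → ℝ} (h : ∀ Y, C.scale Y ≤ k → ∀ u, t (Y, u) = t' (Y, u)) :
    t - t' ∈ goodTables hadd hhom out k g := by
  refine ⟨0, fun u i => ?_⟩
  have h0 : T k g (toBgFamily (t - t')) (out u i) = T k g (toBgFamily 0) (out u i) := by
    rw [hloc k g _ (Set.mem_univ _) (out u i), hloc k g (toBgFamily 0) (Set.mem_univ _) (out u i),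
      truncScale_toBgFamily_eq fun Y hY u => ?_]
    show t (Y, u) - t' (Y, u) = (0 : C.Dom × 𝒰 → ℝ) (Y, u)
    rw [h Y hY u, sub_self]; rfl
  rw [h0, show toBgFamily (0 : C.Dom × 𝒰 → ℝ) = 0 from rfl, channel_zero T hadd, abs_zero, zero_mul]

end Good

/-! ## §3 The linear-extension insertion -/

section Lin

variable {T : ℕ → (ℕ → ℝ) → (𝒰 → C.Dom → ℝ) → ι → ℝ}
variable (hadd : ChannelAdditive (Set.univ : Set (𝒰 → C.Dom → ℝ)) T) (hhom : ChannelHomog (Set.univ : Set (𝒰 → C.Dom → ℝ)) T)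
  (out : 𝒰 → F.Idx → ι)

/-- [folklore] DATA: the step-`k` GOOD PART of a table — its image under the chosen linear retraction onto `goodTables T out k g`. -/
def goodPart (k : ℕ) (g : ℕ → ℝ) (t : C.Dom × 𝒰 → ℝ) : C.Dom × 𝒰 → ℝ :=
  (retraction (goodTables hadd hhom out k g) t : C.Dom × 𝒰 → ℝ)

/-- [folklore] The good part of a good table is the table. -/
theorem goodPart_of_mem {k : ℕ} {g : ℕ → ℝ} {t : C.Dom × 𝒰 → ℝ} (ht : t ∈ goodTables hadd hhom out k g) :
    goodPart hadd hhom out k g t = t :=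
  retraction_of_mem _ ht

/-- [folklore] The good part is good. -/
theorem goodPart_mem (k : ℕ) (g : ℕ → ℝ) (t : C.Dom × 𝒰 → ℝ) :
    goodPart hadd hhom out k g t ∈ goodTables hadd hhom out k g :=
  (retraction _ t).2

/-- [folklore] The good part is additive. -/
theorem goodPart_sub (k : ℕ) (g : ℕ → ℝ) (t t' : C.Dom × 𝒰 → ℝ) :
    goodPart hadd hhom out k g (t - t') = goodPart hadd hhom out k g t - goodPart hadd hhom out k g t' := by
  simp only [goodPart, map_sub, Submodule.coe_sub]

/-- [folklore] The good part is homogeneous. -/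
theorem goodPart_smul (k : ℕ) (g : ℕ → ℝ) (a : ℝ) (t : C.Dom × 𝒰 → ℝ) :
    goodPart hadd hhom out k g (a • t) = a • goodPart hadd hhom out k g t := by
  simp only [goodPart, map_smul, Submodule.coe_smul]

/-- [folklore] The good part of the zero table is zero. -/
theorem goodPart_zero (k : ℕ) (g : ℕ → ℝ) : goodPart hadd hhom out k g 0 = 0 := by
  simp only [goodPart, map_zero, Submodule.coe_zero]

/-- [folklore] DATA: **THE LINEAR-EXTENSION INSERTION OF A FUNCTION TABLE BY THE CHANNEL** — step `0` nothing; step `k + 1` = part 1's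
by-construction insertion of the step-`k` GOOD PART of the table (faithful on the good tables, linear on all of them, never junk). -/
def insLinOfChannel (g : ℕ → ℝ) : ℕ → (C.Dom × 𝒰 → ℝ) → 𝒰 → Hist F
  | 0, _ => fun _ => 0
  | k + 1, t => insAtOfChannel T out g (k + 1) (goodPart hadd hhom out k g t)

/-- [folklore] Step `0` inserts nothing. -/
@[simp] theorem insLinOfChannel_zero (g : ℕ → ℝ) (t : C.Dom × 𝒰 → ℝ) (u : 𝒰) : insLinOfChannel hadd hhom out g 0 t u = (0 : Hist F) := rfl

/-- [folklore] Step `k + 1` inserts the good part through part 1's insertion. -/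
theorem insLinOfChannel_succ (g : ℕ → ℝ) (k : ℕ) (t : C.Dom × 𝒰 → ℝ) (u : 𝒰) :
    insLinOfChannel hadd hhom out g (k + 1) t u =
      tableOf F (chanEntries T out k g (goodPart hadd hhom out k g t) u) := rfl

/-- [folklore] **FAITHFUL ON THE GOOD TABLES**: for a good table the linear-extension insertion IS part 1's by-construction insertion. -/
theorem insLin_eq_insAt_of_mem {g : ℕ → ℝ} {k : ℕ} {t : C.Dom × 𝒰 → ℝ}
    (ht : t ∈ goodTables hadd hhom out k g) (u : 𝒰) :
    insLinOfChannel hadd hhom out g (k + 1) t u = insAtOfChannel T out g (k + 1) t u := by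
  rw [insLinOfChannel_succ, goodPart_of_mem hadd hhom out ht, insAtOfChannel_succ]

/-- [folklore] The entries of the good part are level-bounded at every chart point (so `tableOf` is never the junk value). -/
theorem goodPart_entries_bdd (g : ℕ → ℝ) (k : ℕ) (t : C.Dom × 𝒰 → ℝ) (u : 𝒰) :
    ∃ μ : ℝ, ∀ i, ‖chanEntries T out k g (goodPart hadd hhom out k g t) u i‖ ≤ μ * F.wt i := by
  obtain ⟨μ, hμ⟩ := goodPart_mem hadd hhom out k g t
  exact ⟨μ, fun i => by rw [chanEntries, Complex.norm_real, Real.norm_eq_abs]; exact hμ u i⟩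

/-- [folklore] **THE READING, JUNK-FREE FOR EVERY TABLE**: the entry `i` at the chart point `u` of the step-`k+1` inserted history is the
step-`k` channel output on the background family of the table's GOOD PART (= of the table itself when the table is good). -/
theorem read_insLin_succ (g : ℕ → ℝ) (k : ℕ) (t : C.Dom × 𝒰 → ℝ) (u : 𝒰) (i : F.Idx) :
    F.read (insLinOfChannel hadd hhom out g (k + 1) t u) i =
      ((T k g (toBgFamily (goodPart hadd hhom out k g t)) (out u i) : ℝ) : ℂ) := by
  rw [insLinOfChannel_succ, read_tableOf (goodPart_entries_bdd hadd hhom out g k t u)]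
  rfl

/-- [folklore] **BOUNDED OVER THE CHART FOR EVERY TABLE** (so `famOf` is always verbatim on the linear-extension insertion). -/
theorem bddAbove_insLin (g : ℕ → ℝ) (k : ℕ) (t : C.Dom × 𝒰 → ℝ) :
    BddAbove (Set.range fun u => ‖insLinOfChannel hadd hhom out g k t u‖) := by
  cases k with
  | zero => exact ⟨0, by rintro _ ⟨u, rfl⟩; simp⟩
  | succ k =>
    obtain ⟨μ, hμ⟩ := goodPart_mem hadd hhom out k g t
    refine ⟨max μ 0, ?_⟩
    rintro _ ⟨u, rfl⟩
    refine (F.norm_le_iff_read _ (le_max_right _ _)).2 fun i => ?_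
    rw [read_insLin_succ, Complex.norm_real, Real.norm_eq_abs]
    exact (hμ u i).trans (mul_le_mul_of_nonneg_right (le_max_left _ _) (F.wt_pos i).le)

/-- [folklore] Hence the family model reads the linear-extension insertion VERBATIM at every chart point (`famOf_apply`). -/
theorem famOf_insLin_apply (g : ℕ → ℝ) (k : ℕ) (t : C.Dom × 𝒰 → ℝ) (u : 𝒰) :
    famOf (insLinOfChannel hadd hhom out g k t) u = insLinOfChannel hadd hhom out g k t u :=
  famOf_apply (bddAbove_insLin hadd hhom out g k t) u

end Lin

end Summit.QuantumFields.BalabanUV.T4Continuum.InsertionChannelFamily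

end
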